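import Mathlib
import Summits.Ventures.PercRepro2.SwOutShadowMultiRootKinds
import Summits.Ventures.PercRepro2.SwOutShadowMultiRootAvoid

/-!
# The decorated cube: the hull, the parts and the units along the cube (blind cell PercRepro2,
night-4 g35, 2026-08-29; proofs/NIGHT4-G35.md §4)

g34's CubePoints section for the decorated cube: the extended hull of the roots is constant along
the cube (`extHullR_decoRealRR`), the blue part of a cube point is the union of its `false` arms,
the red part the union of its `true` arms, the base is the cube point `⊤`.  NEW: along the cube
the UNITS are constant — at a cube point the unit of an arm vertex is its unit at the base
(`unitOf_decoRealRR`), under the two canonical conditions: every edge from an arm to the outside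
of the hull goes to its own decoration or to `l` (`NoStray`), and every unit is the cluster of its
arm vertices in the red-unit configuration of the base (`Clustered`) — both hold for the canonical
units of a side point.  Hence the family of units and the decorated base are constant along the
cube (`unitsR_decoRealRR`, `baseDeco_decoRealRR`): the key of the block decomposition.
-/

namespace Summit.Ventures.PercRepro2

namespace LocRows

open Hull

variable {V : Type*} {E : Type*}

open scoped Classical

variable {ends : E → Sym2 V}

section CubePoints

variable {ι : Type*} {A Z : ι → Set V} {b : Config E} {R H : Set V} {l : V} {RR : Finset E}
  (hb : DecoBaseE ends b R H l A Z RR)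
include hb

/-- At a cube point with the unit `i` true, the red edges of the base inside `A i ∪ {r}` are
red. -/
lemma DecoBaseE.insideConfig_le_decoRealRR {ω : Config (ι ⊕ ↥RR)} {i : ι}
    (hi : ω (Sum.inl i) = true) {r : V} (hr : r ∈ R) :
    insideConfig ends (A i ∪ {r}) b ≤ decoRealRR ends A Z RR b ω := by
  intro e
  by_cases he : insideConfig ends (A i ∪ {r}) b e = true
  · rw [he]
    obtain ⟨hbe, x, hx, y, hy, hxy⟩ := insideConfig_eq_true_iff.1 he
    rcases hx with hx | hx
    · rw [hb.decoRealRR_apply_of_mem hxy (Or.inl hx), if_pos hi, hbe]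
    · rcases hy with hy | hy
      · rw [hb.decoRealRR_apply_of_mem (ends_swap hxy) (Or.inl hy), if_pos hi, hbe]
      · rw [Set.mem_singleton_iff] at hx hy
        rcases hx with rfl; rcases hy with rfl
        exact absurd hxy (hb.base.loop_root e _ hr)
  · simp only [Bool.not_eq_true] at he
    rw [he]; exact Bool.false_le _

/-- At a cube point with the unit `i` false, the red edges of the base inside `A i ∪ {r}` are
blue. -/
lemma DecoBaseE.insideConfig_le_blue_decoRealRR {ω : Config (ι ⊕ ↥RR)} {i : ι}
    (hi : ω (Sum.inl i) = false) {r : V} (hr : r ∈ R) :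
    insideConfig ends (A i ∪ {r}) b ≤ blue (decoRealRR ends A Z RR b ω) := by
  intro e
  by_cases he : insideConfig ends (A i ∪ {r}) b e = true
  · rw [he]
    obtain ⟨hbe, x, hx, y, hy, hxy⟩ := insideConfig_eq_true_iff.1 he
    have hi' : ω (Sum.inl i) ≠ true := by rw [hi]; decide
    rcases hx with hx | hx
    · rw [blue_apply, hb.decoRealRR_apply_of_mem hxy (Or.inl hx), if_neg hi', hbe]; rfl
    · rcases hy with hy | hy
      · rw [blue_apply, hb.decoRealRR_apply_of_mem (ends_swap hxy) (Or.inl hy), if_neg hi', hbe]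
        rfl
      · rw [Set.mem_singleton_iff] at hx hy
        rcases hx with rfl; rcases hy with rfl
        exact absurd hxy (hb.base.loop_root e _ hr)
  · simp only [Bool.not_eq_true] at he
    rw [he]; exact Bool.false_le _

/-- Every vertex of `H` lies in the hull of some root at every cube point. -/
theorem DecoBaseE.mem_extHullR_decoRealRR (ω : Config (ι ⊕ ↥RR)) {x : V} (hx : x ∈ H) :
    x ∈ extHullR ends R (decoRealRR ends A Z RR b ω) := by
  by_cases hxR : x ∈ R
  · exact mem_extHullR_of_mem hxR
  obtain ⟨i, hi⟩ := hb.base.arm_cover x hx hxR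
  obtain ⟨r, hr, hc⟩ := hb.base.conn i x hi
  refine ⟨r, hr, ?_⟩
  cases hωi : ω (Sum.inl i) with
  | true => exact Or.inl (cluster_mono (hb.insideConfig_le_decoRealRR hωi hr) r hc)
  | false => exact Or.inr (cluster_mono (hb.insideConfig_le_blue_decoRealRR hωi hr) r hc)

/-- **The extended hull is constant along the decorated cube.** -/
theorem DecoBaseE.extHullR_decoRealRR (ω : Config (ι ⊕ ↥RR)) :
    extHullR ends R (decoRealRR ends A Z RR b ω) = H := by
  apply Set.Subset.antisymm
  · rintro x ⟨r, hr, hx⟩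
    exact hb.hull_subset ω hr hx
  · intro x hx
    exact hb.mem_extHullR_decoRealRR ω hx

/-- **The blue part of a cube point is the union of its `false` arms.** -/
theorem DecoBaseE.bluePartR_decoRealRR (ω : Config (ι ⊕ ↥RR)) :
    bluePartR ends R (decoRealRR ends A Z RR b ω) = armsFalseC A (armPart ω) := by
  ext x
  constructor
  · rintro ⟨⟨r, hr, hx⟩, hxR⟩
    rcases hb.mem_root_or_false_of_mem_cluster_blue ω hr hx with h' | ⟨i, hi, hxi⟩
    · exact absurd h' hxR
    · exact ⟨i, hi, hxi⟩
  · rintro ⟨i, hi, hxi⟩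
    obtain ⟨r, hr, hc⟩ := hb.base.conn i x hxi
    exact ⟨⟨r, hr, cluster_mono (hb.insideConfig_le_blue_decoRealRR hi hr) r hc⟩,
      (hb.base.arm_sub i x hxi).2⟩

/-- **The red part of a cube point is the union of its `true` arms.** -/
theorem DecoBaseE.redPartR_decoRealRR (ω : Config (ι ⊕ ↥RR)) :
    redPartR ends R (decoRealRR ends A Z RR b ω) = armsTrueC A (armPart ω) := by
  ext x
  constructor
  · rintro ⟨⟨r, hr, hx⟩, hxR⟩
    rcases hb.mem_root_or_true_of_mem_cluster ω hr hx with h' | ⟨i, hi, hxi⟩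
    · exact absurd h' hxR
    · exact ⟨i, hi, hxi⟩
  · rintro ⟨i, hi, hxi⟩
    obtain ⟨r, hr, hc⟩ := hb.base.conn i x hxi
    exact ⟨⟨r, hr, cluster_mono (hb.insideConfig_le_decoRealRR hi hr) r hc⟩,
      (hb.base.arm_sub i x hxi).2⟩

omit hb in
/-- The base itself is the cube point `⊤`. -/
lemma DecoBaseE.decoRealRR_top : decoRealRR ends A Z RR b (fun _ => true) = b := by
  funext e
  by_cases he : e ∈ RR
  · rw [decoRealRR_apply_rr he, if_pos rfl]
  · rw [decoRealRR_apply_of_notMem_rr he]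
    have : armsFalseC (unitAZ A Z) (armPart (RR := RR) (fun _ => true)) = ∅ := by
      ext x; simp [armsFalseC, armPart]
    rw [this, flip_apply_of_notMem]
    rintro ⟨x, hx, -⟩
    exact hx

/-- A vertex routed to `l` inside a unit assigned `false` lies in the red cluster of `l`. -/
theorem DecoBaseE.routed_mem_cluster_l_of_false {ω : Config (ι ⊕ ↥RR)} {i : ι}
    (hi : ω (Sum.inl i) = false) {z : V}
    (hz : z ∈ cluster ends (decoRoute ends (unitAZ A Z i) b) l) :
    z ∈ cluster ends (decoRealRR ends A Z RR b ω) l :=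
  cluster_mono (hb.decoRoute_le_decoRealRR hi) l hz

/-- A vertex routed to `l` inside a unit assigned `true` lies in the blue cluster of `l`. -/
theorem DecoBaseE.routed_mem_cluster_blue_l_of_true {ω : Config (ι ⊕ ↥RR)} {i : ι}
    (hi : ω (Sum.inl i) = true) {z : V}
    (hz : z ∈ cluster ends (decoRoute ends (unitAZ A Z i) b) l) :
    z ∈ cluster ends (blue (decoRealRR ends A Z RR b ω)) l :=
  cluster_mono (hb.decoRoute_le_blue_decoRealRR hi) l hz

/-- **A vertex routed to `l` inside a unit escapes at every cube point.** -/
theorem DecoBaseE.routed_mem_hull_l (ω : Config (ι ⊕ ↥RR)) {i : ι} {z : V}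
    (hz : z ∈ cluster ends (decoRoute ends (unitAZ A Z i) b) l) :
    z ∈ hull ends (decoRealRR ends A Z RR b ω) l := by
  cases hi : ω (Sum.inl i) with
  | true => exact Or.inr (hb.routed_mem_cluster_blue_l_of_true hi hz)
  | false => exact Or.inl (hb.routed_mem_cluster_l_of_false hi hz)

end CubePoints

section Units

variable [Fintype E] [DecidableEq E] {ι : Type*} {A Z : ι → Set V} {b : Config E} {R H : Set V}
  {l : V} {RR : Finset E} (hb : DecoBaseE ends b R H l A Z RR)
include hb

omit [Fintype E] [DecidableEq E] in
/-- The extended hull of the base is `H`. -/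
lemma DecoBaseE.extHullR_base : extHullR ends R b = H := by
  have := hb.extHullR_decoRealRR (fun _ => true)
  rwa [DecoBaseE.decoRealRR_top] at this

omit [Fintype E] [DecidableEq E] in
/-- Every arm vertex is in the red part of the base. -/
lemma DecoBaseE.mem_redPartR_base {i : ι} {y : V} (hy : y ∈ A i) : y ∈ redPartR ends R b := by
  have := hb.redPartR_decoRealRR (fun _ => true)
  rw [DecoBaseE.decoRealRR_top] at this
  rw [this]
  exact ⟨i, rfl, hy⟩

omit [Fintype E] [DecidableEq E] in
/-- **A unit is closed under the unit adjacency of any cube point**: an edge of the red-unit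
configuration (a blue edge not at `l`, or an edge inside the hull without the roots) or of the
blue-unit configuration at a cube point leaving a vertex of the unit `i` ends in the unit `i`
(every edge from an arm to the outside of the hull goes to its own decoration or to `l`). -/
lemma DecoBaseE.unit_closed (hN : ∀ i, ∀ e x y, ends e = s(x, y) → x ∈ A i → y ∉ H → y ∈ Z i ∨ y = l)
    (ω : Config (ι ⊕ ↥RR)) {i : ι} {x w : V} {e : E}
    (hxw : ends e = s(x, w)) (hx : x ∈ unitAZ A Z i)
    (he : (decoRealRR ends A Z RR b ω e = true ∧ ω (Sum.inl i) = false ∨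
        decoRealRR ends A Z RR b ω e = false ∧ ω (Sum.inl i) = true) ∧ e ∉ touches ends {l} ∨
      e ∈ within ends (H \ R)) : w ∈ unitAZ A Z i := by
  rcases hx with hx | hx
  · -- `x` in the arm part
    by_cases hwH : w ∈ H
    · by_cases hwR : w ∈ R
      · -- a root edge is red at the base; its colour at `ω` is the unit's colour
        exfalso
        rcases he with ⟨hcol, -⟩ | hin
        · have hred := hb.decoRealRR_root_edge (ω := ω) hwR (ends_swap hxw) hx
          rcases hcol with ⟨h1, h2⟩ | ⟨h1, h2⟩
          · rw [hred.1 h1] at h2; exact absurd h2 (by decide)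
          · have := hred.2 h2; rw [h1] at this; exact absurd this (by decide)
        · obtain ⟨p, hp, q, hq, hpq⟩ := hin
          rw [hxw, Sym2.eq_iff] at hpq
          rcases hpq with ⟨-, hwq⟩ | ⟨-, hwp⟩
          · exact hq.2 (hwq ▸ hwR)
          · exact hp.2 (hwp ▸ hwR)
      · obtain ⟨j, hwj⟩ := hb.base.arm_cover w hwH hwR
        have hij := hb.base.arm_eq_of_edge hxw hx hwj
        subst hij
        exact Or.inl hwj
    · -- an edge from the arm to the outside: to the decoration or to `l`
      rcases hN i e x w hxw hx hwH with hw | hwl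
      · exact Or.inr hw
      · exfalso
        rcases he with ⟨-, hl'⟩ | hin
        · exact hl' ⟨l, Set.mem_singleton l, x, by rw [hxw, hwl]; exact Sym2.eq_swap⟩
        · obtain ⟨p, hp, q, hq, hpq⟩ := hin
          rw [hxw, Sym2.eq_iff] at hpq
          rcases hpq with ⟨-, hwq⟩ | ⟨-, hwp⟩
          · exact hwH (by rw [hwq]; exact hq.1)
          · exact hwH (by rw [hwp]; exact hp.1)
  · -- `x` in the decoration
    rcases hb.deco_edges i e x w hxw hx with hw | hw | hwl
    · exact Or.inl hw
    · exact Or.inr hw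
    · exfalso
      rcases he with ⟨-, hl'⟩ | hin
      · exact hl' ⟨l, Set.mem_singleton l, x, by rw [hxw, hwl]; exact Sym2.eq_swap⟩
      · obtain ⟨p, hp, q, hq, hpq⟩ := hin
        rw [hxw, Sym2.eq_iff] at hpq
        have hwH : w ∈ H := by
          rcases hpq with ⟨-, hwq⟩ | ⟨-, hwp⟩
          · rw [hwq]; exact hq.1
          · rw [hwp]; exact hp.1
        rw [hwl] at hwH
        exact hb.l_notMem hwH

omit [Fintype E] [DecidableEq E] in
/-- **The units are constant along the decorated cube**: at every cube point the unit of an arm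
vertex is its unit at the base (every edge from an arm to the outside goes to its decoration or
to `l`; every unit is the cluster of its arm vertices in the red-unit configuration of the
base). -/
theorem DecoBaseE.unitOf_decoRealRR
    (hN : ∀ i, ∀ e x y, ends e = s(x, y) → x ∈ A i → y ∉ H → y ∈ Z i ∨ y = l)
    (hC : ∀ i, ∀ y ∈ A i, unitAZ A Z i = cluster ends (unitConfigB ends R l b) y)
    (ω : Config (ι ⊕ ↥RR)) {i : ι} {y : V} (hy : y ∈ A i) :
    unitOf ends R l (decoRealRR ends A Z RR b ω) y = unitAZ A Z i := by
  set χ := decoRealRR ends A Z RR b ω with hχ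
  have hHχ : extHullR ends R χ = H := hb.extHullR_decoRealRR ω
  have hHb : extHullR ends R b = H := hb.extHullR_base
  -- the unit at the base is the cluster of `y` in the red-unit configuration of the base
  have hU := hC i y hy
  cases hωi : ω (Sum.inl i) with
  | true =>
    have hyred : y ∈ redPartR ends R χ := by
      rw [hb.redPartR_decoRealRR ω]; exact ⟨i, hωi, hy⟩
    simp only [unitOf, if_pos hyred]
    apply Set.Subset.antisymm
    · -- the cluster stays inside the unit
      intro x hx
      refine mem_of_conn_of_closed (ends := ends) (ω := unitConfigB ends R l χ) ?_ (Or.inl hy) hx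
      intro a ha w haw
      obtain ⟨-, e, he, haw'⟩ := exists_edge_of_adj haw
      refine hb.unit_closed hN ω haw' ha ?_
      rcases unitConfigB_eq_true_iff.1 he with ⟨hblue, hl'⟩ | hin
      · exact Or.inl ⟨Or.inr ⟨hblue, hωi⟩, hl'⟩
      · rw [hHχ] at hin; exact Or.inr hin
    · -- the unit lies in the cluster: its base edges keep their colour at `ω`
      rw [hU]
      refine cluster_subset_of_le_within (S := cluster ends (unitConfigB ends R l b) y)
        (fun _ hx _ hxy => mem_cluster_of_adj hx hxy) (mem_cluster_self _ _ _) ?_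
      intro e he hred
      obtain ⟨a, ha, w, -, haw⟩ := he
      rw [← hU] at ha
      rcases unitConfigB_eq_true_iff.1 hred with ⟨hblue, hl'⟩ | hin
      · refine unitConfigB_eq_true_iff.2 (Or.inl ⟨?_, hl'⟩)
        rw [hχ, hb.decoRealRR_apply_of_mem haw ha, if_pos hωi]; exact hblue
      · refine unitConfigB_eq_true_iff.2 (Or.inr ?_)
        rw [hHχ]; rw [hHb] at hin; exact hin
  | false =>
    have hyblue : y ∈ bluePartR ends R χ := by
      rw [hb.bluePartR_decoRealRR ω]; exact ⟨i, hωi, hy⟩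
    have hyred : y ∉ redPartR ends R χ := by
      intro h'
      rw [hb.redPartR_decoRealRR ω] at h'
      obtain ⟨j, hj, hyj⟩ := h'
      have hij : j = i := by
        by_contra hne
        exact hb.base.arm_disj j i hne y hyj hy
      rw [hij] at hj; simp only [armPart] at hj; rw [hωi] at hj; exact absurd hj (by decide)
    simp only [unitOf, if_neg hyred]
    apply Set.Subset.antisymm
    · intro x hx
      refine mem_of_conn_of_closed (ends := ends) (ω := unitConfigR ends R l χ) ?_ (Or.inl hy) hx
      intro a ha w haw
      obtain ⟨-, e, he, haw'⟩ := exists_edge_of_adj haw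
      refine hb.unit_closed hN ω haw' ha ?_
      rcases unitConfigR_eq_true_iff.1 he with ⟨hred, hl'⟩ | hin
      · exact Or.inl ⟨Or.inl ⟨hred, hωi⟩, hl'⟩
      · rw [hHχ] at hin; exact Or.inr hin
    · rw [hU]
      refine cluster_subset_of_le_within (S := cluster ends (unitConfigB ends R l b) y)
        (fun _ hx _ hxy => mem_cluster_of_adj hx hxy) (mem_cluster_self _ _ _) ?_
      intro e he hred
      obtain ⟨a, ha, w, -, haw⟩ := he
      rw [← hU] at ha
      rcases unitConfigB_eq_true_iff.1 hred with ⟨hblue, hl'⟩ | hin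
      · refine unitConfigR_eq_true_iff.2 (Or.inl ⟨?_, hl'⟩)
        rw [hχ, hb.decoRealRR_apply_of_mem haw ha, if_neg (by rw [hωi]; decide), hblue]; rfl
      · refine unitConfigR_eq_true_iff.2 (Or.inr ?_)
        rw [hHχ]; rw [hHb] at hin; exact hin

omit [Fintype E] [DecidableEq E] in
/-- At the base, the unit of an arm vertex is its unit. -/
lemma DecoBaseE.unitOf_base
    (hN : ∀ i, ∀ e x y, ends e = s(x, y) → x ∈ A i → y ∉ H → y ∈ Z i ∨ y = l)
    (hC : ∀ i, ∀ y ∈ A i, unitAZ A Z i = cluster ends (unitConfigB ends R l b) y)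
    {i : ι} {y : V} (hy : y ∈ A i) : unitOf ends R l b y = unitAZ A Z i := by
  have := hb.unitOf_decoRealRR hN hC (fun _ => true) hy
  rwa [DecoBaseE.decoRealRR_top] at this

/-- **The family of units is constant along the decorated cube.** -/
theorem DecoBaseE.unitsR_decoRealRR
    (hN : ∀ i, ∀ e x y, ends e = s(x, y) → x ∈ A i → y ∉ H → y ∈ Z i ∨ y = l)
    (hC : ∀ i, ∀ y ∈ A i, unitAZ A Z i = cluster ends (unitConfigB ends R l b) y)
    (ω : Config (ι ⊕ ↥RR)) :
    unitsR ends R l (decoRealRR ends A Z RR b ω) = unitsR ends R l b := by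
  unfold unitsR
  apply Finset.image_congr
  intro e he
  simp only [Finset.mem_coe, rootEdgesR, Finset.mem_filter, Finset.mem_univ, true_and] at he
  obtain ⟨r, hr, y, hry, hyR⟩ := he
  show unitOfEdge ends R l (decoRealRR ends A Z RR b ω) e = unitOfEdge ends R l b e
  rw [unitOfEdge_eq hr hry hyR, unitOfEdge_eq hr hry hyR]
  have hyH : y ∈ H := hb.mem_H_of_adj_root hr hry
  obtain ⟨i, hyi⟩ := hb.base.arm_cover y hyH hyR
  rw [hb.unitOf_decoRealRR hN hC ω hyi, hb.unitOf_base hN hC hyi]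

omit [Fintype E] [DecidableEq E] in
/-- **The blue units of a cube point are the units assigned `false`.** -/
theorem DecoBaseE.blueUnits_decoRealRR
    (hN : ∀ i, ∀ e x y, ends e = s(x, y) → x ∈ A i → y ∉ H → y ∈ Z i ∨ y = l)
    (hC : ∀ i, ∀ y ∈ A i, unitAZ A Z i = cluster ends (unitConfigB ends R l b) y)
    (ω : Config (ι ⊕ ↥RR)) :
    blueUnits ends R l (decoRealRR ends A Z RR b ω) = armsFalseC (unitAZ A Z) (armPart ω) := by
  ext x
  constructor
  · rintro ⟨y, hy, hx⟩
    rw [hb.bluePartR_decoRealRR ω] at hy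
    obtain ⟨i, hi, hyi⟩ := hy
    rw [hb.unitOf_decoRealRR hN hC ω hyi] at hx
    exact ⟨i, hi, hx⟩
  · rintro ⟨i, hi, hx⟩
    obtain ⟨y, hy⟩ := hb.base.arm_nonempty i
    refine ⟨y, ?_, ?_⟩
    · rw [hb.bluePartR_decoRealRR ω]; exact ⟨i, hi, hy⟩
    · rw [hb.unitOf_decoRealRR hN hC ω hy]; exact hx

/-- **The decorated base is constant along the decorated cube.** -/
theorem DecoBaseE.baseDeco_decoRealRR (hRR : RR = rrEdges ends R)
    (hN : ∀ i, ∀ e x y, ends e = s(x, y) → x ∈ A i → y ∉ H → y ∈ Z i ∨ y = l)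
    (hC : ∀ i, ∀ y ∈ A i, unitAZ A Z i = cluster ends (unitConfigB ends R l b) y)
    (ω : Config (ι ⊕ ↥RR)) :
    baseDeco ends R l (decoRealRR ends A Z RR b ω) = b := by
  funext e
  by_cases he : e ∈ rrEdges ends R
  · rw [baseDeco_apply_of_mem he]
    obtain ⟨r, hr, r', -, hrr⟩ := mem_rrEdges.1 he
    exact (hb.base.root_red e r r' hr hrr).symm
  · rw [baseDeco_apply_of_notMem he, hb.blueUnits_decoRealRR hN hC ω]
    have he' : e ∉ RR := by rw [hRR]; exact he
    have h1 : decoRealRR ends A Z RR b ω e =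
        Hull.flip ends (armsFalseC (unitAZ A Z) (armPart ω)) b e :=
      decoRealRR_apply_of_notMem_rr he'
    have h2 : ∀ ζ₁ ζ₂ : Config E, ζ₁ e = ζ₂ e →
        Hull.flip ends (armsFalseC (unitAZ A Z) (armPart ω)) ζ₁ e =
          Hull.flip ends (armsFalseC (unitAZ A Z) (armPart ω)) ζ₂ e := by
      intro ζ₁ ζ₂ h'
      by_cases ht : e ∈ touches ends (armsFalseC (unitAZ A Z) (armPart ω))
      · rw [flip_apply_of_mem ht, flip_apply_of_mem ht, h']
      · rw [flip_apply_of_notMem ht, flip_apply_of_notMem ht, h']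
    rw [h2 _ _ h1, Hull.flip_flip]

end Units

end LocRows

end Summit.Ventures.PercRepro2
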